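import Mathlib

/-!
# STUB-IDEAS k3 (`stub_poorRigidCore`, crux `HyperoctahedralThreshold`, stmt-MatrixMultiplication-10883)
# — companion of `STUB-IDEAS-stub_poorRigidCore-3.md` (FAMILY 3: probe the extremes): helper-lemma SIGNATURES H0–H5 + ATOM.

Conventions of the line: `μ c : Equiv.Perm (Fin n)`, words `List (Fin 3)` act on the right
`x · w := w.foldl (fun v c => μ c v) x`; reduced = `List.IsChain (· ≠ ·)`; core conclusion format as in
`stub_poorRigidCore`.  Every statement below is self-contained (no definitions); `sorry` marks what provers prove.
The stub is restated verbatim as `Stub` only to type `H0`.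
-/

set_option linter.unusedVariables false
set_option linter.dupNamespace false

namespace Summit.MatrixMultiplication.MatrixMultiplication.Cruxes.HyperoctahedralThreshold.StubIdeas3

open Finset

/-- verbatim copy of the registered stub `stub_poorRigidCore` (skeleton `Lines/refutation_local_symmetry.lean`). -/
def Stub : Prop :=
  ∃ n₀ : ℕ, ∀ n ≥ n₀, ∀ μ : Fin 3 → Equiv.Perm (Fin n), (∀ i, μ i * μ i = 1 ∧ ∀ v, μ i v ≠ v) → ∀ R : Finset (Fin n), (R.card : ℝ) ≤ (n : ℝ) ^ ((3 : ℝ) / 4) → (∀ z : List (Fin 3), z ≠ [] → List.IsChain (· ≠ ·) (z ++ z) → (z.length : ℝ) ≤ (n : ℝ) ^ ((1 : ℝ) / 4) → ∀ (m : ℕ) (x : Fin m → Fin n), Function.Injective x → (∀ i, z.foldl (fun v c => μ c v) (x i) = x i) → m ≤ (4 * z.length ^ 2) ^ (Nat.log 2 z.length + 1) * (R.card + 1)) → (∀ z : List (Fin 3), z ≠ [] → List.IsChain (· ≠ ·) (z ++ z) → (z.length : ℝ) ≤ (n : ℝ) ^ ((1 : ℝ) / 4) → ∀ (m : ℕ)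 (x : Fin m → Fin n), Function.Injective x → (∀ i, z.foldl (fun v c => μ c v) (x i) = x i) → (∀ i j, ∀ s t : Fin z.length, ((z.take (s : ℕ)).foldl (fun v c => μ c v) (x i) = (z.take (t : ℕ)).foldl (fun v c => μ c v) (x i) ↔ (z.take (s : ℕ)).foldl (fun v c => μ c v) (x j) = (z.take (t : ℕ)).foldl (fun v c => μ c v) (x j))) → m ≤ 2 * (z.length * R.card) + z.length ^ 2 + 1) → ∃ (k : ℕ) (p q : Fin (k + 1) → Fin n) (col : Fin (k + 1) → Fin 3), (∀ i, p i ≠ q i) ∧ (∀ i, (μ (col i) (p i) = p (i + 1) ∧ μ (col i) (q i) = q (i + 1)) ∨ (μ (col i) (p i) = q (i + 1) ∧ μ (col i) (q i) = p (i + 1))) ∧ (∀ i, col i ≠ col (i + 1)) ∧ (∀ i j, (p i = p j ∧ q i = q j) ∨ (p i = q j ∧ q i = p j) ∨ (p i ≠ p j ∧ p i ≠ q j ∧ q i ≠ p j ∧ q i ≠ q j)) ∧ (∀ i, p i ∉ R ∧ q i ∉ R) ∧ ((k : ℝ) + 1) ≤ (n : ℝ) ^ ((1 : ℝ) / 4)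

/-- **H0 · transversal (bulk) reduction** (minimal counterexample in `R`): at the TOP thresholds
`r₀ = ⌊n^{3/4}⌋₊` a COUNTED family `W` of clean closed rung walks with max point-degree `D` and
`|W| > D·r₀` gives the stub for every `R` (`R` kills `≤ D|R|` members; thresholds are monotone in `|R|`). -/
theorem H0_transversal_reduction :
    (∃ n₀ : ℕ, ∀ n ≥ n₀, ∀ μ : Fin 3 → Equiv.Perm (Fin n), (∀ i, μ i * μ i = 1 ∧ ∀ v, μ i v ≠ v) →
      (∀ z : List (Fin 3), z ≠ [] → List.IsChain (· ≠ ·) (z ++ z) → (z.length : ℝ) ≤ (n : ℝ) ^ ((1 : ℝ) / 4) →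
        ∀ (m : ℕ) (x : Fin m → Fin n), Function.Injective x → (∀ i, z.foldl (fun v c => μ c v) (x i) = x i) →
        m ≤ (4 * z.length ^ 2) ^ (Nat.log 2 z.length + 1) * (⌊(n : ℝ) ^ ((3 : ℝ) / 4)⌋₊ + 1)) →
      (∀ z : List (Fin 3), z ≠ [] → List.IsChain (· ≠ ·) (z ++ z) → (z.length : ℝ) ≤ (n : ℝ) ^ ((1 : ℝ) / 4) →
        ∀ (m : ℕ) (x : Fin m → Fin n), Function.Injective x → (∀ i, z.foldl (fun v c => μ c v) (x i) = x i) →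
        (∀ i j, ∀ s t : Fin z.length, ((z.take (s : ℕ)).foldl (fun v c => μ c v) (x i) = (z.take (t : ℕ)).foldl (fun v c => μ c v) (x i) ↔
          (z.take (s : ℕ)).foldl (fun v c => μ c v) (x j) = (z.take (t : ℕ)).foldl (fun v c => μ c v) (x j))) →
        m ≤ 2 * (z.length * ⌊(n : ℝ) ^ ((3 : ℝ) / 4)⌋₊) + z.length ^ 2 + 1) →
      ∃ (k D : ℕ) (W : Finset ((Fin (k + 1) → Fin 3) × (Fin (k + 1) → Fin n) × (Fin (k + 1) → Fin n))),
        (∀ w ∈ W, (∀ i, w.2.1 i ≠ w.2.2 i) ∧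
          (∀ i, (μ (w.1 i) (w.2.1 i) = w.2.1 (i + 1) ∧ μ (w.1 i) (w.2.2 i) = w.2.2 (i + 1)) ∨
            (μ (w.1 i) (w.2.1 i) = w.2.2 (i + 1) ∧ μ (w.1 i) (w.2.2 i) = w.2.1 (i + 1))) ∧
          (∀ i, w.1 i ≠ w.1 (i + 1)) ∧
          (∀ i j, (w.2.1 i = w.2.1 j ∧ w.2.2 i = w.2.2 j) ∨ (w.2.1 i = w.2.2 j ∧ w.2.2 i = w.2.1 j) ∨
            (w.2.1 i ≠ w.2.1 j ∧ w.2.1 i ≠ w.2.2 j ∧ w.2.2 i ≠ w.2.1 j ∧ w.2.2 i ≠ w.2.2 j))) ∧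
        (∀ v : Fin n, (W.filter (fun w => ∃ i, w.2.1 i = v ∨ w.2.2 i = v)).card ≤ D) ∧
        D * ⌊(n : ℝ) ^ ((3 : ℝ) / 4)⌋₊ < W.card ∧ ((k : ℝ) + 1) ≤ (n : ℝ) ^ ((1 : ℝ) / 4)) →
    Stub := by
  sorry

/-- **H1a · `R`-free dart counts: mean bound (bijection trick) and prefix splitting.**
`N v x S` = number of reduced `γ`, `|γ| = S`, `γ ++ [c]` reduced, carrying the ordered pair `(v, x)` onto a
`c`-dart (`x·γ = μ c (v·γ)`) with both trajectories outside `R`.  Cf. `GoodCollisions.sum_good_ge` (p-tree). -/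
theorem H1a_dartCounts : ∀ (n : ℕ) (μ : Fin 3 → Equiv.Perm (Fin n)) (R : Finset (Fin n)) (c : Fin 3)
    (N : Fin n → Fin n → ℕ → ℕ), (∀ b, μ b * μ b = 1) →
    (∀ v x S, N v x S = (((Finset.univ : Finset (List.Vector (Fin 3) S)).image List.Vector.toList).filter
      (fun γ => List.IsChain (· ≠ ·) (γ ++ [c]) ∧ γ.foldl (fun v b => μ b v) x = μ c (γ.foldl (fun v b => μ b v) v) ∧
        ∀ t ≤ S, (γ.take t).foldl (fun v b => μ b v) v ∉ R ∧ (γ.take t).foldl (fun v b => μ b v) x ∉ R)).card) →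
    (∀ S, 2 ^ S * n ≤ (∑ v : Fin n, ∑ x : Fin n, N v x S) + 2 ^ S * (2 * (S + 1) * R.card)) ∧
    (∀ v x, N v x 0 ≤ 1) ∧
    (∀ S a v x, 1 ≤ a → a ≤ S → N v x S ≤
      ∑ α ∈ ((Finset.univ : Finset (List.Vector (Fin 3) a)).image List.Vector.toList).filter (fun α => List.IsChain (· ≠ ·) α),
        N (α.foldl (fun v b => μ b v) v) (α.foldl (fun v b => μ b v) x) (S - a)) := by
  sorry

/-- **H1b · plateau pigeonhole (extremal scale) — pure arithmetic on a count `N` as in H1a.**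
With `K ≥ log₂(2n)` windows of width `W` there is a scale `T ∈ [W, KW]` and a root pair `(v, x)` that is HOT
(`N v x T ≥ 2^T/(2n)`) and WORD-UNIFORM down to depth `W` (`2^{|α|}·N(v·α, x·α, T-|α|) ≤ 3·N v x T`). -/
theorem H1b_plateau : ∀ (n W K : ℕ) (μ : Fin 3 → Equiv.Perm (Fin n)) (N : Fin n → Fin n → ℕ → ℕ),
    0 < n → 1 ≤ W → 2 * n ≤ 2 ^ K →
    (∀ S ≤ K * W, 2 ^ S * n ≤ 2 * ∑ v : Fin n, ∑ x : Fin n, N v x S) →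
    (∀ v x, N v x 0 ≤ 1) →
    (∀ S a v x, 1 ≤ a → a ≤ S → N v x S ≤
      ∑ α ∈ ((Finset.univ : Finset (List.Vector (Fin 3) a)).image List.Vector.toList).filter (fun α => List.IsChain (· ≠ ·) α),
        N (α.foldl (fun v b => μ b v) v) (α.foldl (fun v b => μ b v) x) (S - a)) →
    (∀ a, 1 ≤ a → (((Finset.univ : Finset (List.Vector (Fin 3) a)).image List.Vector.toList).filter
      (fun α => List.IsChain (· ≠ ·) α)).card ≤ 3 * 2 ^ (a - 1)) →
    ∃ T, W ≤ T ∧ T ≤ K * W ∧ ∃ v x : Fin n, 2 ^ T ≤ 2 * n * N v x T ∧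
      ∀ α : List (Fin 3), List.IsChain (· ≠ ·) α → α.length ≤ W →
        2 ^ α.length * N (α.foldl (fun v b => μ b v) v) (α.foldl (fun v b => μ b v) x) (T - α.length) ≤ 3 * N v x T := by
  sorry

/-- **H2 · collisions by Cauchy–Schwarz.**  A word-uniform family `Φ` of `M` words of length `T ≥ a` from a rung
`(v, x)` with `2^a ≥ 6n²` has `≥ M²/(2n²)` ordered prefix-distinct pairs whose length-`a` prefixes carry
`(v, x)` to the same ordered pair.  Cf. `WordCollisions.card_sq_le_card_mul_card_sameImage`. -/
theorem H2_collisions : ∀ (n T a : ℕ) (μ : Fin 3 → Equiv.Perm (Fin n)) (v x : Fin n) (Φ : Finset (List (Fin 3))),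
    (∀ w ∈ Φ, w.length = T) → a ≤ T →
    (∀ α : List (Fin 3), α.length = a → 2 ^ a * (Φ.filter (fun w => w.take a = α)).card ≤ 3 * Φ.card) →
    6 * n ^ 2 ≤ 2 ^ a →
    Φ.card ^ 2 ≤ 2 * n ^ 2 * ((Φ ×ˢ Φ).filter (fun w => w.1.take a ≠ w.2.take a ∧
      (w.1.take a).foldl (fun v b => μ b v) v = (w.2.take a).foldl (fun v b => μ b v) v ∧
      (w.1.take a).foldl (fun v b => μ b v) x = (w.2.take a).foldl (fun v b => μ b v) x)).card := by
  sorry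

/-- **H3 · a GOOD colliding pair is a clean `R`-free closed rung walk (twin type).**  Two distinct reduced words
`β ≠ β'` of length `a` carrying `(v, x)` to the same ordered pair, with `R`-free trajectories and all rungs
`{v·β_s, x·β_s}`, `{v·β'_t, x·β'_t}` pairwise equal-or-disjoint, give the core conclusion with `k + 1 ≤ 2a`
(trim common prefix/suffix as in `TwinSupply.cyclic_of_collision`, then `SameColourTip.twin_cleanWalk`). -/
theorem H3_goodCollision_cleanWalk : ∀ (n a : ℕ) (μ : Fin 3 → Equiv.Perm (Fin n)) (R : Finset (Fin n))
    (v x : Fin n) (β β' : List (Fin 3)), (∀ b, μ b * μ b = 1) → v ≠ x → β.length = a → β'.length = a → β ≠ β' →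
    List.IsChain (· ≠ ·) β → List.IsChain (· ≠ ·) β' →
    β.foldl (fun v b => μ b v) v = β'.foldl (fun v b => μ b v) v → β.foldl (fun v b => μ b v) x = β'.foldl (fun v b => μ b v) x →
    (∀ t ≤ a, (β.take t).foldl (fun v b => μ b v) v ∉ R ∧ (β.take t).foldl (fun v b => μ b v) x ∉ R ∧
      (β'.take t).foldl (fun v b => μ b v) v ∉ R ∧ (β'.take t).foldl (fun v b => μ b v) x ∉ R) →
    (∀ γ γ' : List (Fin 3), (γ = β ∨ γ = β') → (γ' = β ∨ γ' = β') → ∀ s ≤ a, ∀ t ≤ a,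
      ((γ.take s).foldl (fun v b => μ b v) v = (γ'.take t).foldl (fun v b => μ b v) v ∧
          (γ.take s).foldl (fun v b => μ b v) x = (γ'.take t).foldl (fun v b => μ b v) x) ∨
        ((γ.take s).foldl (fun v b => μ b v) v = (γ'.take t).foldl (fun v b => μ b v) x ∧
          (γ.take s).foldl (fun v b => μ b v) x = (γ'.take t).foldl (fun v b => μ b v) v) ∨
        ((γ.take s).foldl (fun v b => μ b v) v ≠ (γ'.take t).foldl (fun v b => μ b v) v ∧
          (γ.take s).foldl (fun v b => μ b v) v ≠ (γ'.take t).foldl (fun v b => μ b v) x ∧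
          (γ.take s).foldl (fun v b => μ b v) x ≠ (γ'.take t).foldl (fun v b => μ b v) v ∧
          (γ.take s).foldl (fun v b => μ b v) x ≠ (γ'.take t).foldl (fun v b => μ b v) x)) →
    ∃ (k : ℕ) (p q : Fin (k + 1) → Fin n) (col : Fin (k + 1) → Fin 3), (∀ i, p i ≠ q i) ∧
      (∀ i, (μ (col i) (p i) = p (i + 1) ∧ μ (col i) (q i) = q (i + 1)) ∨ (μ (col i) (p i) = q (i + 1) ∧ μ (col i) (q i) = p (i + 1))) ∧
      (∀ i, col i ≠ col (i + 1)) ∧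
      (∀ i j, (p i = p j ∧ q i = q j) ∨ (p i = q j ∧ q i = p j) ∨ (p i ≠ p j ∧ p i ≠ q j ∧ q i ≠ p j ∧ q i ≠ q j)) ∧
      (∀ i, p i ∉ R ∧ q i ∉ R) ∧ k + 1 ≤ 2 * a := by
  sorry

/-- **H4 · census (fibre counting under word-uniformity).**  For ANY Boolean test `Bad` on prefix pairs, the
`Φ`-pairs whose length-`a` prefixes are `Bad` number at most `9·|Φ|²/4^a` times the `Bad` pairs of words. -/
theorem H4_census : ∀ (T a : ℕ) (Φ : Finset (List (Fin 3))) (Bad : List (Fin 3) → List (Fin 3) → Bool),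
    (∀ w ∈ Φ, w.length = T) → a ≤ T →
    (∀ α : List (Fin 3), α.length = a → 2 ^ a * (Φ.filter (fun w => w.take a = α)).card ≤ 3 * Φ.card) →
    4 ^ a * ((Φ ×ˢ Φ).filter (fun w => Bad (w.1.take a) (w.2.take a) = true)).card ≤
      9 * Φ.card ^ 2 * ((((Finset.univ : Finset (List.Vector (Fin 3) a)).image List.Vector.toList) ×ˢ
        ((Finset.univ : Finset (List.Vector (Fin 3) a)).image List.Vector.toList)).filter (fun b => Bad b.1 b.2 = true)).card := by
  sorry

/-- **H5 · an `R`-free colour-closed piece is free** (escape clause (i) of the atom): if a nonempty vertex set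
`X` is closed under the three colours, misses `R`, and `|X| + 2 ≤ 2·n^{1/4}`… (stated with the raw bound
`k + 1 ≤ X.card`), the bicoloured `(0,1)`-cycle through a point of `X` is a reflection-symmetric simple cycle
inside `X`, hence core data (`CleanReflection.cleanReflection_walk`). -/
theorem H5_freePiece : ∀ (n : ℕ) (μ : Fin 3 → Equiv.Perm (Fin n)) (R X : Finset (Fin n)),
    (∀ i, μ i * μ i = 1 ∧ ∀ v, μ i v ≠ v) → X.Nonempty → Disjoint X R → (∀ c, ∀ v ∈ X, μ c v ∈ X) →
    ∃ (k : ℕ) (p q : Fin (k + 1) → Fin n) (col : Fin (k + 1) → Fin 3), (∀ i, p i ≠ q i) ∧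
      (∀ i, (μ (col i) (p i) = p (i + 1) ∧ μ (col i) (q i) = q (i + 1)) ∨ (μ (col i) (p i) = q (i + 1) ∧ μ (col i) (q i) = p (i + 1))) ∧
      (∀ i, col i ≠ col (i + 1)) ∧
      (∀ i j, (p i = p j ∧ q i = q j) ∨ (p i = q j ∧ q i = p j) ∨ (p i ≠ p j ∧ p i ≠ q j ∧ q i ≠ p j ∧ q i ≠ q j)) ∧
      (∀ i, p i ∉ R ∧ q i ∉ R) ∧ k + 1 ≤ X.card := by
  sorry

open Classical in
/-- **ATOM (JDC-dichotomy) — the open part, stated on ONE rung at ONE scale, `R`-free, supply-free.**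
For a hot, word-uniform root `(v, x)` (as produced by H1b) at depth `a = ⌈log₂(6n²)⌉`: EITHER the ordered
pairs of distinct reduced words of length `a` that collide as ordered pairs from `(v, x)` and carry a J-defect
(two of the `2(a+1)` rungs sharing exactly one point) are fewer than `4^a/(18n²)`, OR the core conclusion holds
outright.  (POOR/RIGID are available; known sub-cases of the second branch: `R`-light small pieces (H5), heavy
companion-merge atoms = twin-hot rungs ⇒ small orbitals (patternTwin/DeckTwin/InvolutiveSymmetry) — the Γ²-trap
residue is the open wall.) -/
theorem ATOM_JDC : ∃ n₀ : ℕ, ∀ n ≥ n₀, ∀ μ : Fin 3 → Equiv.Perm (Fin n), (∀ i, μ i * μ i = 1 ∧ ∀ v, μ i v ≠ v) →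
    ∀ R : Finset (Fin n), (R.card : ℝ) ≤ (n : ℝ) ^ ((3 : ℝ) / 4) →
    (∀ z : List (Fin 3), z ≠ [] → List.IsChain (· ≠ ·) (z ++ z) → (z.length : ℝ) ≤ (n : ℝ) ^ ((1 : ℝ) / 4) →
      ∀ (m : ℕ) (x : Fin m → Fin n), Function.Injective x → (∀ i, z.foldl (fun v c => μ c v) (x i) = x i) →
      m ≤ (4 * z.length ^ 2) ^ (Nat.log 2 z.length + 1) * (R.card + 1)) →
    (∀ z : List (Fin 3), z ≠ [] → List.IsChain (· ≠ ·) (z ++ z) → (z.length : ℝ) ≤ (n : ℝ) ^ ((1 : ℝ) / 4) →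
      ∀ (m : ℕ) (x : Fin m → Fin n), Function.Injective x → (∀ i, z.foldl (fun v c => μ c v) (x i) = x i) →
      (∀ i j, ∀ s t : Fin z.length, ((z.take (s : ℕ)).foldl (fun v c => μ c v) (x i) = (z.take (t : ℕ)).foldl (fun v c => μ c v) (x i) ↔
        (z.take (s : ℕ)).foldl (fun v c => μ c v) (x j) = (z.take (t : ℕ)).foldl (fun v c => μ c v) (x j))) →
      m ≤ 2 * (z.length * R.card) + z.length ^ 2 + 1) →
    ∀ (c : Fin 3) (T a : ℕ) (v x : Fin n), v ≠ x → a = Nat.clog 2 (6 * n ^ 2) → a ≤ T → 8 * (T + 1) ≤ ⌊(n : ℝ) ^ ((1 : ℝ) / 4)⌋₊ →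
    ∀ N : Fin n → Fin n → ℕ → ℕ,
    (∀ v x S, N v x S = (((Finset.univ : Finset (List.Vector (Fin 3) S)).image List.Vector.toList).filter
      (fun γ => List.IsChain (· ≠ ·) (γ ++ [c]) ∧ γ.foldl (fun v b => μ b v) x = μ c (γ.foldl (fun v b => μ b v) v) ∧
        ∀ t ≤ S, (γ.take t).foldl (fun v b => μ b v) v ∉ R ∧ (γ.take t).foldl (fun v b => μ b v) x ∉ R)).card) →
    2 ^ T ≤ 2 * n * N v x T →
    (∀ α : List (Fin 3), List.IsChain (· ≠ ·) α → α.length ≤ a →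
      2 ^ α.length * N (α.foldl (fun v b => μ b v) v) (α.foldl (fun v b => μ b v) x) (T - α.length) ≤ 3 * N v x T) →
    18 * n ^ 2 * ((((Finset.univ : Finset (List.Vector (Fin 3) a)).image List.Vector.toList) ×ˢ
        ((Finset.univ : Finset (List.Vector (Fin 3) a)).image List.Vector.toList)).filter (fun b =>
        b.1 ≠ b.2 ∧ List.IsChain (· ≠ ·) b.1 ∧ List.IsChain (· ≠ ·) b.2 ∧
        b.1.foldl (fun v d => μ d v) v = b.2.foldl (fun v d => μ d v) v ∧ b.1.foldl (fun v d => μ d v) x = b.2.foldl (fun v d => μ d v) x ∧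
        ¬ ((∀ s ≤ a, ∀ t ≤ a,
          (((b.1).take s).foldl (fun v d => μ d v) v = ((b.1).take t).foldl (fun v d => μ d v) v ∧
              ((b.1).take s).foldl (fun v d => μ d v) x = ((b.1).take t).foldl (fun v d => μ d v) x) ∨
            (((b.1).take s).foldl (fun v d => μ d v) v = ((b.1).take t).foldl (fun v d => μ d v) x ∧
              ((b.1).take s).foldl (fun v d => μ d v) x = ((b.1).take t).foldl (fun v d => μ d v) v) ∨
            (((b.1).take s).foldl (fun v d => μ d v) v ≠ ((b.1).take t).foldl (fun v d => μ d v) v ∧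
              ((b.1).take s).foldl (fun v d => μ d v) v ≠ ((b.1).take t).foldl (fun v d => μ d v) x ∧
              ((b.1).take s).foldl (fun v d => μ d v) x ≠ ((b.1).take t).foldl (fun v d => μ d v) v ∧
              ((b.1).take s).foldl (fun v d => μ d v) x ≠ ((b.1).take t).foldl (fun v d => μ d v) x)) ∧
         (∀ s ≤ a, ∀ t ≤ a,
          (((b.1).take s).foldl (fun v d => μ d v) v = ((b.2).take t).foldl (fun v d => μ d v) v ∧
              ((b.1).take s).foldl (fun v d => μ d v) x = ((b.2).take t).foldl (fun v d => μ d v) x) ∨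
            (((b.1).take s).foldl (fun v d => μ d v) v = ((b.2).take t).foldl (fun v d => μ d v) x ∧
              ((b.1).take s).foldl (fun v d => μ d v) x = ((b.2).take t).foldl (fun v d => μ d v) v) ∨
            (((b.1).take s).foldl (fun v d => μ d v) v ≠ ((b.2).take t).foldl (fun v d => μ d v) v ∧
              ((b.1).take s).foldl (fun v d => μ d v) v ≠ ((b.2).take t).foldl (fun v d => μ d v) x ∧
              ((b.1).take s).foldl (fun v d => μ d v) x ≠ ((b.2).take t).foldl (fun v d => μ d v) v ∧
              ((b.1).take s).foldl (fun v d => μ d v) x ≠ ((b.2).take t).foldl (fun v d => μ d v) x)) ∧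
         (∀ s ≤ a, ∀ t ≤ a,
          (((b.2).take s).foldl (fun v d => μ d v) v = ((b.2).take t).foldl (fun v d => μ d v) v ∧
              ((b.2).take s).foldl (fun v d => μ d v) x = ((b.2).take t).foldl (fun v d => μ d v) x) ∨
            (((b.2).take s).foldl (fun v d => μ d v) v = ((b.2).take t).foldl (fun v d => μ d v) x ∧
              ((b.2).take s).foldl (fun v d => μ d v) x = ((b.2).take t).foldl (fun v d => μ d v) v) ∨
            (((b.2).take s).foldl (fun v d => μ d v) v ≠ ((b.2).take t).foldl (fun v d => μ d v) v ∧
              ((b.2).take s).foldl (fun v d => μ d v) v ≠ ((b.2).take t).foldl (fun v d => μ d v) x ∧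
              ((b.2).take s).foldl (fun v d => μ d v) x ≠ ((b.2).take t).foldl (fun v d => μ d v) v ∧
              ((b.2).take s).foldl (fun v d => μ d v) x ≠ ((b.2).take t).foldl (fun v d => μ d v) x))))).card < 4 ^ a ∨
    ∃ (k : ℕ) (p q : Fin (k + 1) → Fin n) (col : Fin (k + 1) → Fin 3), (∀ i, p i ≠ q i) ∧
      (∀ i, (μ (col i) (p i) = p (i + 1) ∧ μ (col i) (q i) = q (i + 1)) ∨ (μ (col i) (p i) = q (i + 1) ∧ μ (col i) (q i) = p (i + 1))) ∧
      (∀ i, col i ≠ col (i + 1)) ∧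
      (∀ i j, (p i = p j ∧ q i = q j) ∨ (p i = q j ∧ q i = p j) ∨ (p i ≠ p j ∧ p i ≠ q j ∧ q i ≠ p j ∧ q i ≠ q j)) ∧
      (∀ i, p i ∉ R ∧ q i ∉ R) ∧ ((k : ℝ) + 1) ≤ (n : ℝ) ^ ((1 : ℝ) / 4) := by
  sorry

end Summit.MatrixMultiplication.MatrixMultiplication.Cruxes.HyperoctahedralThreshold.StubIdeas3
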